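import Mathlib
import Summits.Ventures.DiscreteObjects.MOLS.CyclicQuasigroupMOLS

/-!
# Orthogonal pairs with a square-swapping symmetry are self-orthogonal pairs `{L, Lᵀ}`

Cell `pub-namedobj`, target (M) "3 MOLS(10)", census family SOLS (designs gen 2). Framing: lottery
ticket; floor = certified bounds/negative ranges.

The orthogonal array of an orthogonal pair `(A, B)` of squares on `α` is the set of 4-tuples
`(x, y, A x y, B x y)`; its automorphisms permute the four coordinates (row, column, `A`-symbol,
`B`-symbol) and relabel the values of each coordinate. This file types the elementary reduction
used by the census:

* `perm_fin4_eq_one_or_derangement`, `fin4_derangement_sq`: if a permutation of the four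
  coordinates fixes pointwise every 3-subset it stabilises (at order 10 this is what
  [McKay–Meynert–Myrvold 2007] gives for a pair inside a triple: every coordinate-triple square of
  the array lies in a set of 3 MOLS, so its autoparatopy group is trivial), then it is the identity
  or fixed-point-free, and a fixed-point-free permutation of four letters is an involution or has a
  fixed-point-free involution as its square. So a non-trivial automorphism group of the pair array
  contains a *swap automorphism*: coordinate part `(row col)(A-symbol B-symbol)`.
* `swapAut_sq_isotopy`: the square of a swap automorphism `(φ₀, φ₁, ψ₂, ψ₃)` is the isotopy
  `(φ₁ ∘ φ₀, φ₀ ∘ φ₁, ψ₃ ∘ ψ₂, ψ₂ ∘ ψ₃)` of the pair; `swapAut_involutive_of_rigid`: if `A` has no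
  non-trivial autotopism (again [MMM 2007] at order 10) the swap automorphism is an involution,
  `φ₁ = φ₀⁻¹`, `ψ₃ = ψ₂⁻¹`.
* `selfOrthogonal_of_swapAut` and `extends_iff_of_swapAut`: for an involutory swap automorphism,
  `L x y := A x (φ₀ y)` is SELF-ORTHOGONAL (`L ⟂ Lᵀ`), `(A, B)` is `(L, ψ₂ ∘ Lᵀ)` with the columns
  of both relabelled by `φ₀⁻¹`, and a square `M` is a common orthogonal mate of `A, B` iff
  `M x (φ₀ y)` is a common orthogonal mate of `L, Lᵀ`. Hence: an orthogonal pair of order 10 with a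
  non-trivial array automorphism extends to a triple only if some self-orthogonal Latin square `L`
  of order 10 has a square orthogonal to both `L` and `Lᵀ` — the finite census object of family
  SOLS (all SOLS(10) up to isomorphism).
* `diag_injective_of_selfOrthogonal`: the diagonal of a self-orthogonal square takes distinct
  values (so a SOLS can be relabelled to be idempotent, the normal form the census enumerates);
  `sols4`: kernel-checked order-4 control (a SOLS(4) with a common mate of it and its transpose).

Nothing published is used as a hypothesis; [MMM 2007] enters only the informal reading above.
-/

namespace Summit.Ventures.DiscreteObjects.MOLS

section coordinates

set_option maxRecDepth 20000 in
set_option synthInstance.maxHeartbeats 400000 in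
set_option synthInstance.maxSize 1024 in
/-- A permutation of the four coordinates of a pair array that fixes pointwise every 3-subset it
stabilises is the identity or fixed-point-free (kernel `decide` over `S₄`). -/
theorem perm_fin4_eq_one_or_derangement (π : Equiv.Perm (Fin 4))
    (h : ∀ T : Finset (Fin 4), T.card = 3 → (∀ i ∈ T, π i ∈ T) → ∀ i ∈ T, π i = i) :
    π = 1 ∨ ∀ i, π i ≠ i := by
  revert π
  decide

set_option maxRecDepth 20000 in
set_option synthInstance.maxHeartbeats 400000 in
set_option synthInstance.maxSize 1024 in
/-- A fixed-point-free permutation of four letters is an involution, or its square is a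
fixed-point-free involution (kernel `decide`): a non-trivial automorphism group of a pair array
whose coordinate parts are all fixed-point-free contains one with coordinate part of cycle type
`2+2`, i.e. (up to renaming the coordinates) the swap `(row col)(A-symbol B-symbol)`. -/
theorem fin4_derangement_sq (π : Equiv.Perm (Fin 4)) (h : ∀ i, π i ≠ i) :
    π ^ 2 = 1 ∨ ((∀ i, (π ^ 2) i ≠ i) ∧ (π ^ 2) ^ 2 = 1) := by
  revert π
  decide

set_option maxRecDepth 20000 in
set_option synthInstance.maxHeartbeats 400000 in
set_option synthInstance.maxSize 1024 in
/-- The three conjugacy-class representatives of cycle type `2+2` in `S₄` exhaust the fixed-point-free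
involutions: such a `π` swaps two disjoint pairs of coordinates (kernel `decide`). -/
theorem fin4_fpf_involution_pairs (π : Equiv.Perm (Fin 4)) (h : ∀ i, π i ≠ i) (h2 : π ^ 2 = 1) :
    π = Equiv.swap 0 1 * Equiv.swap 2 3 ∨ π = Equiv.swap 0 2 * Equiv.swap 1 3 ∨
      π = Equiv.swap 0 3 * Equiv.swap 1 2 := by
  revert π
  decide

end coordinates

section swap

variable {α : Type*}

/-- `f⁻¹ (f x) = x` for a permutation, keeping the group-inverse notation. -/
theorem solsPerm_inv_apply_self (f : Equiv.Perm α) (x : α) : f⁻¹ (f x) = x :=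
  f.symm_apply_apply x

/-- `f (f⁻¹ x) = x` for a permutation, keeping the group-inverse notation. -/
theorem solsPerm_apply_inv_self (f : Equiv.Perm α) (x : α) : f (f⁻¹ x) = x :=
  f.apply_symm_apply x

/-- A *swap automorphism* of the array of the pair `(A, B)`: bijections `φ₀` (row values ↦ column
values), `φ₁` (column ↦ row), `ψ₂` (`A`-symbols ↦ `B`-symbols), `ψ₃` (`B` ↦ `A`) such that the
image `(φ₁ y, φ₀ x, ψ₃ (B x y), ψ₂ (A x y))` of the tuple of every cell `(x, y)` is again a tuple of
the array, i.e. the cell `(φ₁ y, φ₀ x)` carries `A = ψ₃ (B x y)` and `B = ψ₂ (A x y)`. -/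
def IsSwapAut (A B : α → α → α) (φ₀ φ₁ ψ₂ ψ₃ : Equiv.Perm α) : Prop :=
  ∀ x y, A (φ₁ y) (φ₀ x) = ψ₃ (B x y) ∧ B (φ₁ y) (φ₀ x) = ψ₂ (A x y)

/-- An *autotopism* `(r, c, s)` of a square: `A (r x) (c y) = s (A x y)`. -/
def IsAutotopism (A : α → α → α) (r c s : Equiv.Perm α) : Prop :=
  ∀ x y, A (r x) (c y) = s (A x y)

/-- The square of a swap automorphism is an isotopy of the pair: `(φ₁ ∘ φ₀, φ₀ ∘ φ₁, ψ₃ ∘ ψ₂)` is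
an autotopism of `A` (and symmetrically `(φ₁ ∘ φ₀, φ₀ ∘ φ₁, ψ₂ ∘ ψ₃)` one of `B`). -/
theorem swapAut_sq_isotopy {A B : α → α → α} {φ₀ φ₁ ψ₂ ψ₃ : Equiv.Perm α}
    (h : IsSwapAut A B φ₀ φ₁ ψ₂ ψ₃) :
    IsAutotopism A (φ₁ * φ₀) (φ₀ * φ₁) (ψ₃ * ψ₂) ∧ IsAutotopism B (φ₁ * φ₀) (φ₀ * φ₁) (ψ₂ * ψ₃) := by
  refine ⟨fun x y => ?_, fun x y => ?_⟩
  · simp only [Equiv.Perm.coe_mul, Function.comp_apply]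
    rw [(h (φ₁ y) (φ₀ x)).1, (h x y).2]
  · simp only [Equiv.Perm.coe_mul, Function.comp_apply]
    rw [(h (φ₁ y) (φ₀ x)).2, (h x y).1]

/-- If `A` is *rigid* (only the trivial autotopism — at order 10, for a square inside a set of
3 MOLS, this is [McKay–Meynert–Myrvold 2007]) then a swap automorphism is an involution:
`φ₁ = φ₀⁻¹` and `ψ₃ = ψ₂⁻¹`. -/
theorem swapAut_involutive_of_rigid {A B : α → α → α} {φ₀ φ₁ ψ₂ ψ₃ : Equiv.Perm α}
    (h : IsSwapAut A B φ₀ φ₁ ψ₂ ψ₃)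
    (rigid : ∀ r c s : Equiv.Perm α, IsAutotopism A r c s → r = 1 ∧ c = 1 ∧ s = 1) :
    φ₁ = φ₀⁻¹ ∧ ψ₃ = ψ₂⁻¹ := by
  obtain ⟨h1, -, h3⟩ := rigid _ _ _ (swapAut_sq_isotopy h).1
  exact ⟨by rw [eq_inv_iff_mul_eq_one]; exact h1, by rw [eq_inv_iff_mul_eq_one]; exact h3⟩

/-- The square `L x y := A x (φ₀ y)` attached to an involutory swap automorphism. -/
def swapSquare (A : α → α → α) (φ₀ : Equiv.Perm α) (x y : α) : α := A x (φ₀ y)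

/-- Normal form: under an involutory swap automorphism, `A x y = L x (φ₀⁻¹ y)` and
`B x y = ψ₂ (L (φ₀⁻¹ y) x)` — the pair is `(L, ψ₂ ∘ Lᵀ)` with columns relabelled by `φ₀⁻¹`. -/
theorem pair_eq_of_swapAut {A B : α → α → α} {φ₀ ψ₂ : Equiv.Perm α}
    (h : IsSwapAut A B φ₀ φ₀⁻¹ ψ₂ ψ₂⁻¹) (x y : α) :
    A x y = swapSquare A φ₀ x (φ₀⁻¹ y) ∧ B x y = ψ₂ (swapSquare A φ₀ (φ₀⁻¹ y) x) := by
  refine ⟨by simp [swapSquare], ?_⟩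
  have h1 := (h x y).1
  simp only [swapSquare]
  rw [h1]
  simp

/-- **Self-orthogonality.** If `A ⟂ B` and the pair has an involutory swap automorphism, then
`L = swapSquare A φ₀` is orthogonal to its transpose. -/
theorem selfOrthogonal_of_swapAut {A B : α → α → α} {φ₀ ψ₂ : Equiv.Perm α}
    (hAB : Orthogonal A B) (h : IsSwapAut A B φ₀ φ₀⁻¹ ψ₂ ψ₂⁻¹) :
    Orthogonal (swapSquare A φ₀) (fun x y => swapSquare A φ₀ y x) := by
  intro x y x' y' ha hb
  -- cells (x, φ₀ y) and (x', φ₀ y') of (A, B) carry equal A-values and equal B-values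
  have hb' : B x (φ₀ y) = B x' (φ₀ y') := by
    have e1 := (h x (φ₀ y)).1
    have e2 := (h x' (φ₀ y')).1
    simp only [solsPerm_inv_apply_self] at e1 e2
    simp only [swapSquare] at hb
    -- hb : A y (φ₀ x) = A y' (φ₀ x')
    have : ψ₂⁻¹ (B x (φ₀ y)) = ψ₂⁻¹ (B x' (φ₀ y')) := by rw [← e1, ← e2, hb]
    exact ψ₂⁻¹.injective this
  have := hAB x (φ₀ y) x' (φ₀ y') ha hb'
  exact ⟨this.1, φ₀.injective this.2⟩

/-- Latin-ness transfers to the normal form. -/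
theorem isLatin_swapSquare {A : α → α → α} (φ₀ : Equiv.Perm α) (hA : IsLatin A) :
    IsLatin (swapSquare A φ₀) :=
  ⟨fun x _ _ hxy => φ₀.injective (hA.1 x _ _ hxy), fun y x x' hxy => hA.2 (φ₀ y) x x' hxy⟩

/-- **Transfer of common mates.** Under an involutory swap automorphism, a square `M` is
orthogonal to both `A` and `B` iff `M' x y := M x (φ₀ y)` is orthogonal to both `L` and `Lᵀ`
(`L = swapSquare A φ₀`). So `(A, B)` lies in a set of three MOLS iff `(L, Lᵀ)` does. -/
theorem extends_iff_of_swapAut {A B : α → α → α} {φ₀ ψ₂ : Equiv.Perm α}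
    (h : IsSwapAut A B φ₀ φ₀⁻¹ ψ₂ ψ₂⁻¹) (M : α → α → α) :
    (Orthogonal M A ∧ Orthogonal M B) ↔
      (Orthogonal (fun x y => M x (φ₀ y)) (swapSquare A φ₀) ∧
        Orthogonal (fun x y => M x (φ₀ y)) (fun x y => swapSquare A φ₀ y x)) := by
  -- B in terms of L
  have hB : ∀ x y, B x (φ₀ y) = ψ₂ (swapSquare A φ₀ y x) := by
    intro x y
    have := (pair_eq_of_swapAut h x (φ₀ y)).2
    simpa using this
  constructor
  · rintro ⟨hMA, hMB⟩
    refine ⟨fun x y x' y' hm ha => ?_, fun x y x' y' hm hl => ?_⟩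
    · have := hMA x (φ₀ y) x' (φ₀ y') hm ha
      exact ⟨this.1, φ₀.injective this.2⟩
    · have hl' : swapSquare A φ₀ y x = swapSquare A φ₀ y' x' := hl
      have hb : B x (φ₀ y) = B x' (φ₀ y') := by rw [hB, hB, hl']
      have := hMB x (φ₀ y) x' (φ₀ y') hm hb
      exact ⟨this.1, φ₀.injective this.2⟩
  · rintro ⟨hML, hMLt⟩
    refine ⟨fun x y x' y' hm ha => ?_, fun x y x' y' hm hb => ?_⟩
    · have hm' : M x (φ₀ (φ₀⁻¹ y)) = M x' (φ₀ (φ₀⁻¹ y')) := by simpa using hm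
      have ha' : swapSquare A φ₀ x (φ₀⁻¹ y) = swapSquare A φ₀ x' (φ₀⁻¹ y') := by
        simpa [swapSquare] using ha
      have := hML x (φ₀⁻¹ y) x' (φ₀⁻¹ y') hm' ha'
      exact ⟨this.1, by simpa using congrArg φ₀ this.2⟩
    · have hm' : M x (φ₀ (φ₀⁻¹ y)) = M x' (φ₀ (φ₀⁻¹ y')) := by simpa using hm
      have hb' : swapSquare A φ₀ (φ₀⁻¹ y) x = swapSquare A φ₀ (φ₀⁻¹ y') x' := by
        have e1 := hB x (φ₀⁻¹ y)
        have e2 := hB x' (φ₀⁻¹ y')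
        simp only [solsPerm_apply_inv_self] at e1 e2
        apply ψ₂.injective
        rw [← e1, ← e2, hb]
      have := hMLt x (φ₀⁻¹ y) x' (φ₀⁻¹ y') hm' hb'
      exact ⟨this.1, by simpa using congrArg φ₀ this.2⟩

/-- The diagonal of a self-orthogonal square takes pairwise distinct values (the cells `(x,x)` and
`(x',x')` carry the pairs `(L x x, L x x)` and `(L x' x', L x' x')`). Hence on a finite carrier the
diagonal is a bijection and relabelling symbols by its inverse makes the square idempotent — the
normal form enumerated by the census. -/
theorem diag_injective_of_selfOrthogonal {L : α → α → α}
    (h : Orthogonal L (fun x y => L y x)) : Function.Injective (fun x => L x x) := by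
  intro x x' hxx
  exact (h x x x' x' hxx hxx).1

end swap

section example4

/-- Order-4 control: the idempotent SOLS(4) found by the census engines (class representative,
rows `[0,2,3,1],[3,1,0,2],[1,3,2,0],[2,0,1,3]`). -/
def sols4 (x y : Fin 4) : Fin 4 :=
  ![![0, 2, 3, 1], ![3, 1, 0, 2], ![1, 3, 2, 0], ![2, 0, 1, 3]] x y

/-- A common orthogonal mate of `sols4` and its transpose found by the extension engine
(rows `[0,1,2,3],[1,0,3,2],[2,3,0,1],[3,2,1,0]`). -/
def mate4 (x y : Fin 4) : Fin 4 :=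
  ![![0, 1, 2, 3], ![1, 0, 3, 2], ![2, 3, 0, 1], ![3, 2, 1, 0]] x y

/-- control (+): `sols4` is a Latin square orthogonal to its transpose (kernel `decide`). -/
theorem sols4_selfOrthogonal :
    IsLatin sols4 ∧ Orthogonal sols4 (fun x y => sols4 y x) := by
  unfold IsLatin Orthogonal sols4; refine ⟨⟨?_, ?_⟩, ?_⟩ <;> decide

/-- control (+): `{sols4, sols4ᵀ, mate4}` are three MOLS(4) — the pair `{L, Lᵀ}` extends to a
triple at order 4 (kernel `decide`). -/
theorem sols4_extends : IsLatin mate4 ∧ Orthogonal mate4 sols4 ∧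
    Orthogonal mate4 (fun x y => sols4 y x) := by
  unfold IsLatin Orthogonal sols4 mate4; refine ⟨⟨?_, ?_⟩, ?_, ?_⟩ <;> decide

end example4

end Summit.Ventures.DiscreteObjects.MOLS
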